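import Literature.Probability.Process.GaussianTaylorStep
import Mathlib.Probability.Independence.Basic
import Mathlib.Probability.Process.Adapted
import Mathlib.Probability.Martingale.Basic
import Mathlib.MeasureTheory.Integral.Prod
import Mathlib.MeasureTheory.Integral.IntervalIntegral.Basic
import Mathlib.Analysis.SpecialFunctions.Integrals.Basic
import HarnessLib

/-!
# `d`-dimensional Brownian motion as a hypothesis structure; Dynkin's martingale `f(W_t) − ½∫₀ᵗ Δf(W_r) dr`

Topic `Probability/Process`. A **`d`-dimensional Brownian motion** is packaged as a predicate
`IsBrownianVec W P` on a process `W : ℝ≥0 → Ω → (Fin d → ℝ)`: measurable marginals, continuous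
paths (every `ω`), `W_0 = 0`, the **weak Markov property at deterministic times** (the shifted
process `u ↦ W_{s+u} − W_s` is independent of the past `(W_r)_{r ≤ s}` and has the law of `W`)
and the Gaussian marginals `W_t ~ N(0, t I_d)` (`gaussVec d t` of `GaussianTaylorStep`). This is
the list of properties of Brownian motion used below and in the sibling files; a model (four
independent canonical Brownian motions on a product of Wiener spaces) is given in
`BrownianVecModel`.

Main result — **Dynkin's formula / the martingale problem for `½Δ` on `C²_c`**
(`IsBrownianVec.martingale_dynkin`): for `f : ℝᵈ → ℝ` of class `C²` with compact support and
`x₀ ∈ ℝᵈ`,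

  `M^f_t = f(x₀ + W_t) − f(x₀) − ½ ∫₀ᵗ Δf(x₀ + W_r) dr`

is a martingale for the natural filtration of `W` (Le Gall (2016), Thm. 6.14 and the Example
following it, where it is derived from Itô's formula). The proof here is elementary: for `s ≤ t`
and `B ∈ σ(W_r : r ≤ s)`, telescope `f(x₀+W_t) − f(x₀+W_s)` over the grid `r_k = s + k(t−s)/n`;
by the weak Markov property each increment contributes `E[𝟙_B G_h(x₀ + W_{r_k})]` with
`G_h(y) = E f(y + ξ_h) − f(y)`, `ξ_h ~ N(0, hI)`, and `|G_h(y) − (h/2)Δf(y)| ≤ εh` uniformly in `y`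
(`gaussVec_integral_taylor`); the Riemann sums `∑ h Δf(x₀ + W_{r_k})` converge pathwise to
`∫ₛᵗ Δf(x₀ + W_r) dr` (`tendsto_riemannSum_of_continuousOn`), so `E[𝟙_B (M_t − M_s)] = 0`.

Also proved: the natural filtration and its description by the past process
(`natFiltration_eq_comap_vecPast`), the independence/Fubini lemma
`integral_comp_eq_integral_integral_of_indepFun`, the law of the increments
(`IsBrownianVec.map_incr`), adaptedness and boundedness of `M^f`. No named fact is introduced.

## References

* J.-F. Le Gall, *Brownian Motion, Martingales, and Stochastic Calculus*, GTM 274 (2016), Ch. 2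
  (simple Markov property of Brownian motion), Ch. 6 Thm. 6.14 and the Example after it
  (`h(X_t) − ½∫₀ᵗ Δh(X_s) ds` is a martingale for `h, Δh ∈ C_0(ℝᵈ)`). [Legall2016]
-/

noncomputable section

open MeasureTheory ProbabilityTheory Filter Topology Set Finset
open scoped NNReal ENNReal BigOperators

namespace Literature.Probability.Process

variable {Ω : Type*} {mΩ : MeasurableSpace Ω} {P : Measure Ω} {d : ℕ}

/-! ### Path functionals of a vector process -/

/-- The whole path `u ↦ W_u(ω)`. [folklore] -/
def vecPath (W : ℝ≥0 → Ω → (Fin d → ℝ)) (ω : Ω) : ℝ≥0 → (Fin d → ℝ) := fun u ↦ W u ω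

/-- The shifted path `u ↦ W_{s+u}(ω) − W_s(ω)`. [folklore] -/
def vecShift (W : ℝ≥0 → Ω → (Fin d → ℝ)) (s : ℝ≥0) (ω : Ω) : ℝ≥0 → (Fin d → ℝ) :=
  fun u ↦ W (s + u) ω - W s ω

/-- The past `(W_r(ω))_{r ≤ s}`. [folklore] -/
def vecPast (W : ℝ≥0 → Ω → (Fin d → ℝ)) (s : ℝ≥0) (ω : Ω) : Set.Iic s → (Fin d → ℝ) :=
  fun r ↦ W r ω

/-- **`d`-dimensional Brownian motion** as a hypothesis structure: measurable marginals,
continuous paths, `W_0 = 0`, the weak Markov property at deterministic times (independence of the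
shifted process from the past, and its law), and the Gaussian marginals `W_t ~ N(0, t I_d)`.
[cite: Legall2016, Ch. 2 (simple Markov property) and Ch. 7 §7.1] -/
structure IsBrownianVec (W : ℝ≥0 → Ω → (Fin d → ℝ)) (P : Measure Ω) : Prop where
  measurable : ∀ t, Measurable (W t)
  continuous_path : ∀ ω, Continuous (W · ω)
  apply_zero : ∀ ω, W 0 ω = 0
  indep_shift : ∀ s, IndepFun (vecShift W s) (vecPast W s) P
  map_shift : ∀ s, P.map (vecShift W s) = P.map (vecPath W)
  map_apply : ∀ t, P.map (W t) = gaussVec d t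

namespace IsBrownianVec

variable {W : ℝ≥0 → Ω → (Fin d → ℝ)}

/-- The path map is measurable. [folklore] -/
theorem measurable_vecPath (hW : IsBrownianVec W P) : Measurable (vecPath W) :=
  measurable_pi_lambda _ fun u ↦ hW.measurable u

/-- The shifted path map is measurable. [folklore] -/
theorem measurable_vecShift (hW : IsBrownianVec W P) (s : ℝ≥0) : Measurable (vecShift W s) :=
  measurable_pi_lambda _ fun u ↦ (hW.measurable (s + u)).sub (hW.measurable s)

/-- The past map is measurable. [folklore] -/
theorem measurable_vecPast (hW : IsBrownianVec W P) (s : ℝ≥0) : Measurable (vecPast W s) :=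
  measurable_pi_lambda _ fun r ↦ hW.measurable r

/-- Joint continuity in time is not needed; continuity of `r ↦ g(x₀ + W_r(ω))` for continuous
`g`. [folklore] -/
theorem continuous_comp_path (hW : IsBrownianVec W P) {g : (Fin d → ℝ) → ℝ} (hg : Continuous g)
    (x₀ : Fin d → ℝ) (ω : Ω) : Continuous fun r : ℝ≥0 ↦ g (x₀ + W r ω) :=
  hg.comp (continuous_const.add (hW.continuous_path ω))

/-! ### The natural filtration -/

/-- **The natural filtration** `σ(W_r : r ≤ t)` of the vector process (Mathlib
`Filtration.natural`, raw: neither completed nor made right-continuous). [folklore] -/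
def natFiltration (hW : IsBrownianVec W P) : Filtration ℝ≥0 mΩ :=
  Filtration.natural (fun t ↦ W t) fun t ↦ (hW.measurable t).stronglyMeasurable

/-- `W` is adapted to its natural filtration. [folklore] -/
theorem stronglyAdapted (hW : IsBrownianVec W P) : StronglyAdapted hW.natFiltration fun t ↦ W t :=
  Filtration.stronglyAdapted_natural _

/-- `W_r` is `𝓕_t`-measurable for `r ≤ t`. [folklore] -/
theorem measurable_apply_le (hW : IsBrownianVec W P) {r t : ℝ≥0} (hrt : r ≤ t) :
    Measurable[hW.natFiltration t] (W r) :=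
  ((hW.stronglyAdapted r).measurable).mono (hW.natFiltration.mono hrt) le_rfl

/-- The natural filtration at time `s` is generated by the past process:
`𝓕_s = σ(vecPast W s)`. [folklore] -/
theorem natFiltration_eq_comap_vecPast (hW : IsBrownianVec W P) (s : ℝ≥0) :
    hW.natFiltration s = MeasurableSpace.comap (vecPast W s) inferInstance :=
  Filtration.natural_eq_comap _ _ s

/-- **The weak Markov property in σ-algebra form**: the shifted process is independent of `𝓕_s`.
[cite: Legall2016, Ch. 2 (simple Markov property of Brownian motion)] -/
theorem indep_comap_vecShift_natFiltration (hW : IsBrownianVec W P) (s : ℝ≥0) :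
    Indep (MeasurableSpace.comap (vecShift W s) inferInstance) (hW.natFiltration s) P := by
  rw [natFiltration_eq_comap_vecPast]
  exact (IndepFun_iff_Indep _ _ _).1 (hW.indep_shift s)

/-! ### Independence and Fubini -/

/-- **Integrating out an independent variable**: if `U ⟂ ξ` then
`E g(U, ξ) = E[ ∫ g(U, e) dLaw(ξ)(e) ]` for bounded measurable `g`. [folklore] -/
theorem integral_comp_eq_integral_integral_of_indepFun {α β : Type*} [MeasurableSpace α]
    [MeasurableSpace β] [IsProbabilityMeasure P] {U : Ω → α} {ξ : Ω → β} (hU : Measurable U)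
    (hξ : Measurable ξ) (hind : IndepFun U ξ P) {g : α × β → ℝ} (hg : Measurable g) {C : ℝ}
    (hC : ∀ p, |g p| ≤ C) :
    ∫ ω, g (U ω, ξ ω) ∂P = ∫ ω, (∫ e, g (U ω, e) ∂(P.map ξ)) ∂P := by
  have hprod := (indepFun_iff_map_prod_eq_prod_map_map hU.aemeasurable hξ.aemeasurable).1 hind
  haveI : IsProbabilityMeasure (P.map U) := Measure.isProbabilityMeasure_map hU.aemeasurable
  haveI : IsProbabilityMeasure (P.map ξ) := Measure.isProbabilityMeasure_map hξ.aemeasurable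
  have hgi : Integrable g ((P.map U).prod (P.map ξ)) :=
    Integrable.mono' (integrable_const C) hg.aestronglyMeasurable
      (Eventually.of_forall fun p ↦ by simpa [Real.norm_eq_abs] using hC p)
  calc ∫ ω, g (U ω, ξ ω) ∂P = ∫ p, g p ∂(P.map fun ω ↦ (U ω, ξ ω)) := by
        rw [integral_map (hU.prodMk hξ).aemeasurable hg.aestronglyMeasurable]
    _ = ∫ p, g p ∂((P.map U).prod (P.map ξ)) := by rw [hprod]
    _ = ∫ u, (∫ e, g (u, e) ∂(P.map ξ)) ∂(P.map U) := integral_prod g hgi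
    _ = ∫ ω, (∫ e, g (U ω, e) ∂(P.map ξ)) ∂P := by
        rw [integral_map hU.aemeasurable]
        exact (hg.stronglyMeasurable.integral_prod_right').aestronglyMeasurable

/-! ### Increments -/

/-- The increment `W_{s+h} − W_s` is the shifted path evaluated at `h`. [folklore] -/
theorem incr_eq_vecShift (s h : ℝ≥0) (ω : Ω) : W (s + h) ω - W s ω = vecShift W s ω h := rfl

/-- **The increments are `N(0, h I_d)`**: `W_{s+h} − W_s ~ gaussVec d h`.
[cite: Legall2016, Ch. 2 (simple Markov property of Brownian motion)] -/
theorem map_incr (hW : IsBrownianVec W P) (s h : ℝ≥0) :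
    P.map (fun ω ↦ W (s + h) ω - W s ω) = gaussVec d h := by
  have h1 : (fun ω ↦ W (s + h) ω - W s ω) = (fun p : ℝ≥0 → (Fin d → ℝ) ↦ p h) ∘ vecShift W s := rfl
  have h2 : W h = (fun p : ℝ≥0 → (Fin d → ℝ) ↦ p h) ∘ vecPath W := rfl
  rw [h1, ← Measure.map_map (measurable_pi_apply h) (hW.measurable_vecShift s), hW.map_shift s,
    Measure.map_map (measurable_pi_apply h) hW.measurable_vecPath, ← h2, hW.map_apply h]

/-- The increment is measurable with respect to the σ-algebra of the shifted process. [folklore] -/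
theorem measurable_incr_comap (s h : ℝ≥0) :
    Measurable[MeasurableSpace.comap (vecShift W s) inferInstance] fun ω ↦ W (s + h) ω - W s ω := by
  have h1 : (fun ω ↦ W (s + h) ω - W s ω) = (fun p : ℝ≥0 → (Fin d → ℝ) ↦ p h) ∘ vecShift W s := rfl
  rw [h1]
  exact (measurable_pi_apply h).comp (comap_measurable (vecShift W s))

/-- **One step of the telescoping sum.** For `B ∈ 𝓕_r`, a bounded measurable `φ` and the
increment `ξ = W_{r+h} − W_r`:
`E[𝟙_B φ(W_r, ξ)] = E[𝟙_B ∫ φ(W_r, e) dN(0, hI)(e)]`. [folklore] -/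
theorem integral_indicator_mul_comp_incr [IsProbabilityMeasure P] (hW : IsBrownianVec W P)
    {r h : ℝ≥0} {B : Set Ω} (hB : MeasurableSet[hW.natFiltration r] B)
    {φ : (Fin d → ℝ) × (Fin d → ℝ) → ℝ} (hφ : Measurable φ) {C : ℝ} (hC : ∀ p, |φ p| ≤ C) :
    ∫ ω, B.indicator (fun _ ↦ (1 : ℝ)) ω * φ (W r ω, W (r + h) ω - W r ω) ∂P =
      ∫ ω, B.indicator (fun _ ↦ (1 : ℝ)) ω * ∫ e, φ (W r ω, e) ∂gaussVec d h ∂P := by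
  have hle : hW.natFiltration r ≤ mΩ := hW.natFiltration.le r
  have hBm : MeasurableSet B := hle _ hB
  -- `U = (𝟙_B, W_r)` is `𝓕_r`-measurable, `ξ` is `σ(shift)`-measurable; they are independent
  set U : Ω → ℝ × (Fin d → ℝ) := fun ω ↦ (B.indicator (fun _ ↦ (1 : ℝ)) ω, W r ω) with hU
  set ξ : Ω → (Fin d → ℝ) := fun ω ↦ W (r + h) ω - W r ω with hξ
  have hUm' : Measurable[hW.natFiltration r] U :=
    ((measurable_const.indicator hB)).prodMk (hW.measurable_apply_le le_rfl)
  have hUm : Measurable U := hUm'.mono hle le_rfl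
  have hξm : Measurable ξ := (hW.measurable (r + h)).sub (hW.measurable r)
  have hind : IndepFun U ξ P := by
    rw [IndepFun_iff_Indep]
    have h1 := (hW.indep_comap_vecShift_natFiltration r).symm
    refine indep_of_indep_of_le_right (indep_of_indep_of_le_left h1 ?_) ?_
    · exact hUm'.comap_le
    · exact (measurable_incr_comap r h).comap_le
  -- clamp the first coordinate to `[0, 1]` to keep the test function bounded
  have hgm : Measurable fun p : (ℝ × (Fin d → ℝ)) × (Fin d → ℝ) ↦
      max 0 (min 1 p.1.1) * φ (p.1.2, p.2) :=
    (measurable_const.max (measurable_const.min (measurable_fst.comp measurable_fst))).mul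
      (hφ.comp ((measurable_snd.comp measurable_fst).prodMk measurable_snd))
  have hgC : ∀ p : (ℝ × (Fin d → ℝ)) × (Fin d → ℝ), |max 0 (min 1 p.1.1) * φ (p.1.2, p.2)| ≤ C := by
    intro p
    rw [abs_mul]
    have h1 : |max 0 (min 1 p.1.1)| ≤ 1 := by
      rw [abs_of_nonneg (le_max_left _ _)]
      exact max_le zero_le_one (min_le_left _ _)
    calc |max 0 (min 1 p.1.1)| * |φ (p.1.2, p.2)| ≤ 1 * C :=
          mul_le_mul h1 (hC _) (abs_nonneg _) zero_le_one
      _ = C := one_mul C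
  have hclamp : ∀ ω, max 0 (min 1 (B.indicator (fun _ ↦ (1 : ℝ)) ω)) =
      B.indicator (fun _ ↦ (1 : ℝ)) ω := fun ω ↦ by
    by_cases hω : ω ∈ B <;> simp [hω]
  have key := integral_comp_eq_integral_integral_of_indepFun hUm hξm hind hgm hgC
  simp only [hU, hξ, hclamp] at key
  rw [hW.map_incr r h] at key
  rw [key]
  refine integral_congr_ae (Eventually.of_forall fun ω ↦ ?_)
  exact integral_const_mul _ _

end IsBrownianVec

/-! ### Riemann sums of a continuous function -/

/-- **Left Riemann sums converge to the integral** for a function continuous on `[a, b]`: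
`∑_{k<n} ((b−a)/n) φ(a + k(b−a)/n) → ∫ₐᵇ φ`. [folklore] -/
theorem tendsto_riemannSum_of_continuousOn {φ : ℝ → ℝ} {a b : ℝ} (hab : a ≤ b)
    (hφ : ContinuousOn φ (Icc a b)) :
    Tendsto (fun n : ℕ ↦ ∑ k ∈ Finset.range n, (b - a) / n * φ (a + k * ((b - a) / n)))
      atTop (𝓝 (∫ r in a..b, φ r)) := by
  rw [Metric.tendsto_atTop]
  intro ε hε
  -- uniform continuity on `[a, b]`
  obtain ⟨δ, hδ, hδε⟩ := Metric.uniformContinuousOn_iff.1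
    (isCompact_Icc.uniformContinuousOn_of_continuous hφ) (ε / (b - a + 1)) (by positivity)
  -- choose `N` with `(b - a)/N < δ`
  obtain ⟨N, hN⟩ := exists_nat_gt ((b - a) / δ)
  refine ⟨max N 1, fun n hn ↦ ?_⟩
  have hn1 : 1 ≤ n := le_of_max_le_right hn
  have hnpos : (0 : ℝ) < n := by exact_mod_cast hn1
  set h : ℝ := (b - a) / n with hh
  have hh0 : 0 ≤ h := div_nonneg (sub_nonneg.2 hab) hnpos.le
  have hhδ : h < δ := by
    rw [hh, div_lt_iff₀ hnpos]
    have : (b - a) / δ < n := hN.trans_le (by exact_mod_cast le_of_max_le_left hn)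
    rw [div_lt_iff₀ hδ] at this
    linarith
  -- the grid
  set g : ℕ → ℝ := fun k ↦ a + k * h with hg
  have hg0 : g 0 = a := by simp [hg]
  have hgn : g n = b := by
    simp only [hg, hh]
    field_simp
    ring
  have hgsucc : ∀ k, g (k + 1) = g k + h := fun k ↦ by simp only [hg]; push_cast; ring
  have hgmono : ∀ k, g k ≤ g (k + 1) := fun k ↦ by rw [hgsucc]; linarith
  have hga : ∀ k, a ≤ g k := fun k ↦ by
    simp only [hg]; nlinarith [hh0, (Nat.cast_nonneg k : (0 : ℝ) ≤ k)]
  have hgb : ∀ k ≤ n, g k ≤ b := fun k hk ↦ by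
    rw [← hgn]; simp only [hg]
    have : (k : ℝ) ≤ n := by exact_mod_cast hk
    nlinarith [hh0]
  have hint : ∀ k < n, IntervalIntegrable φ volume (g k) (g (k + 1)) := fun k hk ↦
    (hφ.mono (Icc_subset_Icc (hga k) (hgb (k + 1) hk))).intervalIntegrable_of_Icc (hgmono k)
  -- `∫ₐᵇ φ = ∑ ∫_{g k}^{g (k+1)} φ`
  have hsplit : ∫ r in a..b, φ r = ∑ k ∈ Finset.range n, ∫ r in g k..g (k + 1), φ r := by
    rw [intervalIntegral.sum_integral_adjacent_intervals hint, hg0, hgn]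
  rw [hsplit, Real.dist_eq, ← Finset.sum_sub_distrib]
  -- each term is small
  have hterm : ∀ k ∈ Finset.range n, |(b - a) / n * φ (a + k * ((b - a) / n)) -
      ∫ r in g k..g (k + 1), φ r| ≤ ε / (b - a + 1) * h := by
    intro k hk
    rw [Finset.mem_range] at hk
    have h1 : (b - a) / n * φ (a + k * ((b - a) / n)) = ∫ _ in g k..g (k + 1), φ (g k) := by
      rw [intervalIntegral.integral_const, hgsucc, add_sub_cancel_left, smul_eq_mul, mul_comm]
    rw [h1, ← intervalIntegral.integral_sub intervalIntegrable_const (hint k hk)]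
    have h2 := intervalIntegral.norm_integral_le_of_norm_le_const (a := g k) (b := g (k + 1))
      (f := fun r ↦ φ (g k) - φ r) (C := ε / (b - a + 1)) fun r hr ↦ ?_
    · have h3 : |g (k + 1) - g k| = h := by rw [hgsucc, add_sub_cancel_left, abs_of_nonneg hh0]
      rw [h3] at h2
      simpa [Real.norm_eq_abs] using h2
    · rw [Set.uIoc_of_le (hgmono k)] at hr
      rw [Real.norm_eq_abs, ← Real.dist_eq]
      refine (hδε (g k) ⟨hga k, hgb k hk.le⟩ r ⟨(hga k).trans hr.1.le, hr.2.trans (hgb (k + 1) hk)⟩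
        ?_).le
      rw [Real.dist_eq, abs_sub_comm, abs_of_nonneg (sub_nonneg.2 hr.1.le)]
      calc r - g k ≤ g (k + 1) - g k := by linarith [hr.2]
        _ = h := by rw [hgsucc]; ring
        _ < δ := hhδ
  calc |∑ k ∈ Finset.range n, ((b - a) / n * φ (a + k * ((b - a) / n)) - ∫ r in g k..g (k + 1), φ r)|
      ≤ ∑ k ∈ Finset.range n, |(b - a) / n * φ (a + k * ((b - a) / n)) - ∫ r in g k..g (k + 1), φ r| :=
        Finset.abs_sum_le_sum_abs _ _
    _ ≤ ∑ k ∈ Finset.range n, ε / (b - a + 1) * h := Finset.sum_le_sum hterm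
    _ = ε * ((b - a) / (b - a + 1)) := by
        rw [Finset.sum_const, Finset.card_range, nsmul_eq_mul, hh]
        field_simp
    _ < ε := by
        have : (b - a) / (b - a + 1) < 1 := by
          rw [div_lt_one (by linarith)]; linarith
        nlinarith

namespace IsBrownianVec

variable {W : ℝ≥0 → Ω → (Fin d → ℝ)}

/-! ### Dynkin's martingale -/

/-- **Dynkin's process** `M^f_t = f(x₀ + W_t) − f(x₀) − ½ ∫₀ᵗ Δf(x₀ + W_r) dr` (real time in the
integral, read through `Real.toNNReal`). [cite: Legall2016, Ch. 6 Thm. 6.14 and the Example following it] -/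
def dynkin (f : (Fin d → ℝ) → ℝ) (x₀ : Fin d → ℝ) (W : ℝ≥0 → Ω → (Fin d → ℝ)) (t : ℝ≥0) (ω : Ω) : ℝ :=
  f (x₀ + W t ω) - f x₀ - 1 / 2 * ∫ r in (0 : ℝ)..t, lap f (x₀ + W r.toNNReal ω)

variable {f : (Fin d → ℝ) → ℝ} {x₀ : Fin d → ℝ}

/-- The integrand `r ↦ Δf(x₀ + W_r(ω))` (real time) is continuous. [folklore] -/
theorem continuous_lap_path (hW : IsBrownianVec W P) (hf : ContDiff ℝ 2 f) (x₀ : Fin d → ℝ) (ω : Ω) :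
    Continuous fun r : ℝ ↦ lap f (x₀ + W r.toNNReal ω) :=
  (hW.continuous_comp_path (continuous_lap hf) x₀ ω).comp continuous_real_toNNReal

/-- Increments of Dynkin's process: for `s ≤ t`,
`M_t − M_s = f(x₀+W_t) − f(x₀+W_s) − ½ ∫ₛᵗ Δf(x₀+W_r) dr`. [folklore] -/
theorem dynkin_sub (hW : IsBrownianVec W P) (hf : ContDiff ℝ 2 f) {s t : ℝ≥0} (ω : Ω) :
    dynkin f x₀ W t ω - dynkin f x₀ W s ω =
      f (x₀ + W t ω) - f (x₀ + W s ω) - 1 / 2 * ∫ r in (s : ℝ)..t, lap f (x₀ + W r.toNNReal ω) := by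
  have hc := hW.continuous_lap_path hf x₀ ω
  have e := intervalIntegral.integral_interval_sub_left (hc.intervalIntegrable (μ := volume) 0 t)
    (hc.intervalIntegrable (μ := volume) 0 s)
  rw [dynkin, dynkin, ← e]
  ring

/-- A bounded measurable real function is integrable on a probability space. [folklore] -/
theorem integrable_of_abs_le [IsProbabilityMeasure P] {g : Ω → ℝ} (hg : Measurable g) {C : ℝ}
    (hC : ∀ ω, |g ω| ≤ C) : Integrable g P :=
  Integrable.mono' (integrable_const C) hg.aestronglyMeasurable
    (Eventually.of_forall fun ω ↦ by simpa [Real.norm_eq_abs] using hC ω)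

/-- **The Gaussian smoothing `G_h f(y) = E f(y + ξ_h) − f(y)`**. [folklore] -/
def gaussStep (f : (Fin d → ℝ) → ℝ) (h : ℝ≥0) (y : Fin d → ℝ) : ℝ :=
  ∫ e, f (y + e) ∂gaussVec d h - f y

/-- `G_h f` is measurable. [folklore] -/
theorem measurable_gaussStep (hf : ContDiff ℝ 2 f) (h : ℝ≥0) : Measurable (gaussStep f h) := by
  unfold gaussStep
  refine Measurable.sub ?_ hf.continuous.measurable
  have hsm : StronglyMeasurable (Function.uncurry fun (y e : Fin d → ℝ) ↦ f (y + e)) :=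
    (hf.continuous.comp (continuous_fst.add continuous_snd)).stronglyMeasurable
  exact (hsm.integral_prod_right (ν := gaussVec d h)).measurable

/-- `|G_h f| ≤ 2 sup|f|`. [folklore] -/
theorem abs_gaussStep_le (hf : ContDiff ℝ 2 f) (hc : HasCompactSupport f) (h : ℝ≥0) :
    ∃ C, ∀ y, |gaussStep f h y| ≤ C := by
  obtain ⟨C, hC⟩ := exists_bound_of_hasCompactSupport hf hc
  refine ⟨C + C, fun y ↦ (abs_sub _ _).trans (add_le_add ?_ (hC y))⟩
  calc |∫ e, f (y + e) ∂gaussVec d h| ≤ ∫ e, |f (y + e)| ∂gaussVec d h := abs_integral_le_integral_abs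
    _ ≤ ∫ _, C ∂gaussVec d h := integral_mono (integrable_comp_add hf hc y).abs (integrable_const C)
        fun e ↦ hC (y + e)
    _ = C := by simp

/-- **One increment of `f(x₀ + W)` against a past event**: for `B ∈ 𝓕_r`,
`E[𝟙_B (f(x₀ + W_{r+h}) − f(x₀ + W_r))] = E[𝟙_B G_h f(x₀ + W_r)]`. [folklore] -/
theorem integral_indicator_mul_sub_eq [IsProbabilityMeasure P] (hW : IsBrownianVec W P)
    (hf : ContDiff ℝ 2 f) (hc : HasCompactSupport f) {r h : ℝ≥0} {B : Set Ω}
    (hB : MeasurableSet[hW.natFiltration r] B) :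
    ∫ ω, B.indicator (fun _ ↦ (1 : ℝ)) ω * (f (x₀ + W (r + h) ω) - f (x₀ + W r ω)) ∂P =
      ∫ ω, B.indicator (fun _ ↦ (1 : ℝ)) ω * gaussStep f h (x₀ + W r ω) ∂P := by
  obtain ⟨C, hC⟩ := exists_bound_of_hasCompactSupport hf hc
  have hφm : Measurable fun p : (Fin d → ℝ) × (Fin d → ℝ) ↦ f (x₀ + p.1 + p.2) - f (x₀ + p.1) :=
    (hf.continuous.measurable.comp ((measurable_const.add measurable_fst).add measurable_snd)).sub
      (hf.continuous.measurable.comp (measurable_const.add measurable_fst))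
  have hφC : ∀ p : (Fin d → ℝ) × (Fin d → ℝ), |f (x₀ + p.1 + p.2) - f (x₀ + p.1)| ≤ C + C :=
    fun p ↦ (abs_sub _ _).trans (add_le_add (hC _) (hC _))
  have key := hW.integral_indicator_mul_comp_incr (h := h) hB hφm hφC
  have hW' : ∀ ω, x₀ + W r ω + (W (r + h) ω - W r ω) = x₀ + W (r + h) ω := fun ω ↦ by abel
  simp only [hW'] at key
  rw [key]
  refine integral_congr_ae (Eventually.of_forall fun ω ↦ ?_)
  simp only [gaussStep]
  congr 1
  rw [integral_sub (integrable_comp_add hf hc _) (integrable_const _)]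
  simp

/-! ### Boundedness and adaptedness of Dynkin's process -/

/-- The Laplacian of a `C²_c` function is bounded. [folklore] -/
theorem exists_bound_lap (hf : ContDiff ℝ 2 f) (hc : HasCompactSupport f) : ∃ C, 0 ≤ C ∧ ∀ y, |lap f y| ≤ C := by
  have hcl : HasCompactSupport (lap f) := by
    refine (hasCompactSupport_hessMat hc).mono ?_   -- support lap ⊆ support hessMat
    intro y hy
    rw [Function.mem_support] at hy ⊢
    contrapose! hy
    simp only [lap]
    refine Finset.sum_eq_zero fun i _ ↦ ?_
    have := congr_fun hy (i, i)
    simpa [hessMat] using this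
  obtain ⟨C, hC⟩ := (continuous_lap hf).bounded_above_of_compact_support hcl
  exact ⟨max C 0, le_max_right _ _, fun y ↦ (by simpa [Real.norm_eq_abs] using hC y : |lap f y| ≤ C).trans
    (le_max_left _ _)⟩

/-- `|∫ₐᵇ Δf(x₀ + W_r) dr| ≤ C_Δ |b − a|`. [folklore] -/
theorem abs_integral_lap_le {C : ℝ} (hC : ∀ y, |lap f y| ≤ C) (a b : ℝ) (ω : Ω) :
    |∫ r in a..b, lap f (x₀ + W r.toNNReal ω)| ≤ C * |b - a| := by
  have := intervalIntegral.norm_integral_le_of_norm_le_const (a := a) (b := b)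
    (f := fun r ↦ lap f (x₀ + W r.toNNReal ω)) (C := C) fun r _ ↦ by
      rw [Real.norm_eq_abs]; exact hC _
  simpa [Real.norm_eq_abs] using this

/-- **Dynkin's process is bounded on bounded time intervals**:
`|M_t| ≤ 2 sup|f| + ½ sup|Δf| · t`. [folklore] -/
theorem abs_dynkin_le (hf : ContDiff ℝ 2 f) (hc : HasCompactSupport f) :
    ∃ C₁ C₂, 0 ≤ C₁ ∧ 0 ≤ C₂ ∧ ∀ t ω, |dynkin f x₀ W t ω| ≤ C₁ + C₂ * t := by
  obtain ⟨Cf, hCf⟩ := exists_bound_of_hasCompactSupport hf hc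
  obtain ⟨CL, hCL0, hCL⟩ := exists_bound_lap hf hc
  have hCf0 : 0 ≤ Cf := (abs_nonneg _).trans (hCf 0)
  refine ⟨Cf + Cf, 1 / 2 * CL, by positivity, by positivity, fun t ω ↦ ?_⟩
  rw [dynkin]
  have h1 := abs_integral_lap_le (W := W) hCL (x₀ := x₀) 0 t ω
  rw [sub_zero, abs_of_nonneg t.coe_nonneg] at h1
  calc |f (x₀ + W t ω) - f x₀ - 1 / 2 * ∫ r in (0 : ℝ)..t, lap f (x₀ + W r.toNNReal ω)|
      ≤ |f (x₀ + W t ω)| + |f x₀| + |1 / 2 * ∫ r in (0 : ℝ)..t, lap f (x₀ + W r.toNNReal ω)| :=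
        (abs_sub _ _).trans (by gcongr; exact abs_sub _ _)
    _ ≤ Cf + Cf + 1 / 2 * (CL * t) := by
        rw [abs_mul, abs_of_pos (by norm_num : (0 : ℝ) < 1 / 2)]
        gcongr
        · exact hCf _
        · exact hCf _
    _ = Cf + Cf + 1 / 2 * CL * t := by ring

/-- The grid `s + k (t − s)/n` of `[s, t]` in `ℝ≥0`. [folklore] -/
def grid (s t : ℝ≥0) (n k : ℕ) : ℝ≥0 := s + k • ((t - s) / n)

/-- `grid 0 = s`. [folklore] -/
theorem grid_zero (s t : ℝ≥0) (n : ℕ) : grid s t n 0 = s := by simp [grid]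

/-- `grid (k+1) = grid k + (t − s)/n`. [folklore] -/
theorem grid_succ (s t : ℝ≥0) (n k : ℕ) : grid s t n (k + 1) = grid s t n k + (t - s) / n := by
  simp only [grid, succ_nsmul, add_assoc]

/-- `grid n = t` for `s ≤ t`, `n ≠ 0`. [folklore] -/
theorem grid_self {s t : ℝ≥0} (hst : s ≤ t) {n : ℕ} (hn : n ≠ 0) : grid s t n n = t := by
  rw [grid, nsmul_eq_mul, mul_div_cancel₀ _ (Nat.cast_ne_zero.2 hn), add_tsub_cancel_of_le hst]

/-- `s ≤ grid k`. [folklore] -/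
theorem le_grid (s t : ℝ≥0) (n k : ℕ) : s ≤ grid s t n k := by simp [grid]

/-- `grid k ≤ t` for `k ≤ n`. [folklore] -/
theorem grid_le {s t : ℝ≥0} (hst : s ≤ t) {n k : ℕ} (hk : k ≤ n) : grid s t n k ≤ t := by
  rcases Nat.eq_zero_or_pos n with rfl | hn
  · simp only [grid, Nat.cast_zero, div_zero, smul_zero, add_zero]; exact hst
  · calc grid s t n k ≤ grid s t n n := by
          simp only [grid, nsmul_eq_mul]; gcongr
      _ = t := grid_self hst hn.ne'

/-- The grid points as real numbers. [folklore] -/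
theorem coe_grid {s t : ℝ≥0} (hst : s ≤ t) (n k : ℕ) :
    (grid s t n k : ℝ) = s + k * (((t : ℝ) - s) / n) := by
  simp only [grid, nsmul_eq_mul, NNReal.coe_add, NNReal.coe_mul, NNReal.coe_natCast, NNReal.coe_div,
    NNReal.coe_sub hst]

/-- The Riemann sums of `r ↦ Δf(x₀ + W_r)` on the `ℝ≥0`-grid. [folklore] -/
def riemannLap (f : (Fin d → ℝ) → ℝ) (x₀ : Fin d → ℝ) (W : ℝ≥0 → Ω → (Fin d → ℝ)) (s t : ℝ≥0)
    (n : ℕ) (ω : Ω) : ℝ :=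
  ∑ k ∈ Finset.range n, (((t : ℝ) - s) / n) * lap f (x₀ + W (grid s t n k) ω)

/-- **Pathwise convergence of the Riemann sums** to `∫ₛᵗ Δf(x₀ + W_r) dr`. [folklore] -/
theorem tendsto_riemannLap (hW : IsBrownianVec W P) (hf : ContDiff ℝ 2 f) {s t : ℝ≥0} (hst : s ≤ t)
    (ω : Ω) :
    Tendsto (fun n ↦ riemannLap f x₀ W s t n ω) atTop
      (𝓝 (∫ r in (s : ℝ)..t, lap f (x₀ + W r.toNNReal ω))) := by
  have hc := (hW.continuous_lap_path hf x₀ ω).continuousOn (s := Icc (s : ℝ) t)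
  have key := tendsto_riemannSum_of_continuousOn (NNReal.coe_le_coe.2 hst) hc
  refine key.congr fun n ↦ Finset.sum_congr rfl fun k _ ↦ ?_
  congr 2
  rw [← coe_grid hst n k, Real.toNNReal_coe]

/-- The Riemann sums are bounded. [folklore] -/
theorem abs_riemannLap_le {C : ℝ} (hC0 : 0 ≤ C) (hC : ∀ y, |lap f y| ≤ C)
    {s t : ℝ≥0} (hst : s ≤ t) (n : ℕ) (ω : Ω) : |riemannLap f x₀ W s t n ω| ≤ C * (t - s) := by
  rcases Nat.eq_zero_or_pos n with rfl | hn
  · simp only [riemannLap, Finset.range_zero, Finset.sum_empty, abs_zero]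
    exact mul_nonneg hC0 (sub_nonneg.2 (NNReal.coe_le_coe.2 hst))
  have hts : (0 : ℝ) ≤ t - s := sub_nonneg.2 (NNReal.coe_le_coe.2 hst)
  calc |riemannLap f x₀ W s t n ω|
      ≤ ∑ k ∈ Finset.range n, |(((t : ℝ) - s) / n) * lap f (x₀ + W (grid s t n k) ω)| :=
        Finset.abs_sum_le_sum_abs _ _
    _ ≤ ∑ k ∈ Finset.range n, (((t : ℝ) - s) / n) * C := Finset.sum_le_sum fun k _ ↦ by
        rw [abs_mul, abs_of_nonneg (by positivity)]
        gcongr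
        exact hC _
    _ = C * (t - s) := by
        rw [Finset.sum_const, Finset.card_range, nsmul_eq_mul]
        field_simp

/-- The Riemann sums are `𝓕_t`-measurable. [folklore] -/
theorem measurable_riemannLap (hW : IsBrownianVec W P) (hf : ContDiff ℝ 2 f) {s t : ℝ≥0} (hst : s ≤ t)
    (n : ℕ) : Measurable[hW.natFiltration t] (riemannLap f x₀ W s t n) := by
  refine Finset.measurable_sum _ fun k hk ↦ Measurable.const_mul ?_ _
  rw [Finset.mem_range] at hk
  exact (continuous_lap hf).measurable.comp
    (measurable_const.add (hW.measurable_apply_le (grid_le hst hk.le)))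

/-- **The time integral `∫₀ᵗ Δf(x₀ + W_r) dr` is `𝓕_t`-measurable** (pointwise limit of Riemann
sums over times `≤ t`). [folklore] -/
theorem stronglyMeasurable_integral_lap (hW : IsBrownianVec W P) (hf : ContDiff ℝ 2 f) {s t : ℝ≥0}
    (hst : s ≤ t) :
    StronglyMeasurable[hW.natFiltration t] fun ω ↦ ∫ r in (s : ℝ)..t, lap f (x₀ + W r.toNNReal ω) := by
  refine stronglyMeasurable_of_tendsto (f := fun n ↦ riemannLap f x₀ W s t n) atTop
    (fun n ↦ (hW.measurable_riemannLap hf hst n).stronglyMeasurable) ?_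
  rw [tendsto_pi_nhds]
  exact fun ω ↦ hW.tendsto_riemannLap hf hst ω

/-- **Dynkin's process is adapted** to the natural filtration. [folklore] -/
theorem stronglyAdapted_dynkin (hW : IsBrownianVec W P) (hf : ContDiff ℝ 2 f) :
    StronglyAdapted hW.natFiltration (dynkin f x₀ W) := fun t ↦ by
  have h1 : StronglyMeasurable[hW.natFiltration t] fun ω ↦ f (x₀ + W t ω) :=
    (hf.continuous.measurable.comp (measurable_const.add (hW.measurable_apply_le le_rfl))).stronglyMeasurable
  have h2 := hW.stronglyMeasurable_integral_lap hf (x₀ := x₀) (s := 0) (t := t) bot_le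
  simp only [NNReal.coe_zero] at h2
  exact (h1.sub stronglyMeasurable_const).sub (h2.const_mul _)

/-- Dynkin's process is measurable. [folklore] -/
theorem measurable_dynkin (hW : IsBrownianVec W P) (hf : ContDiff ℝ 2 f) (t : ℝ≥0) :
    Measurable (dynkin f x₀ W t) :=
  ((hW.stronglyAdapted_dynkin hf t).measurable).mono (hW.natFiltration.le t) le_rfl

/-- Dynkin's process is integrable. [folklore] -/
theorem integrable_dynkin [IsProbabilityMeasure P] (hW : IsBrownianVec W P) (hf : ContDiff ℝ 2 f)
    (hc : HasCompactSupport f) (t : ℝ≥0) : Integrable (dynkin f x₀ W t) P := by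
  obtain ⟨C₁, C₂, -, -, hb⟩ := abs_dynkin_le (W := W) hf hc (x₀ := x₀)
  exact integrable_of_abs_le (hW.measurable_dynkin hf t) fun ω ↦ hb t ω

/-- Dynkin's process has continuous paths. [folklore] -/
theorem continuous_dynkin (hW : IsBrownianVec W P) (hf : ContDiff ℝ 2 f) (ω : Ω) :
    Continuous fun t ↦ dynkin f x₀ W t ω := by
  have hc := hW.continuous_lap_path hf x₀ ω
  have h1 : Continuous fun t : ℝ≥0 ↦ ∫ r in (0 : ℝ)..t, lap f (x₀ + W r.toNNReal ω) :=
    (intervalIntegral.continuous_primitive (fun _ _ ↦ hc.intervalIntegrable _ _) 0).comp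
      continuous_subtype_val
  unfold dynkin
  exact ((hW.continuous_comp_path hf.continuous x₀ ω).sub continuous_const).sub (h1.const_mul _)

/-! ### The martingale property -/

/-- Integrability of `𝟙_B g` for bounded measurable `g`. [folklore] -/
theorem integrable_indicator_mul [IsProbabilityMeasure P] {B : Set Ω} (hB : MeasurableSet B)
    {g : Ω → ℝ} (hg : Measurable g) {C : ℝ} (hC : ∀ ω, |g ω| ≤ C) :
    Integrable (fun ω ↦ B.indicator (fun _ ↦ (1 : ℝ)) ω * g ω) P := by
  refine integrable_of_abs_le ((measurable_const.indicator hB).mul hg) (C := C) fun ω ↦ ?_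
  by_cases hω : ω ∈ B
  · simpa [hω] using hC ω
  · simp [hω, (abs_nonneg _).trans (hC ω)]

/-- **The core identity**: for `s ≤ t` and `B ∈ 𝓕_s`,
`E[𝟙_B (f(x₀ + W_t) − f(x₀ + W_s))] = E[𝟙_B · ½ ∫ₛᵗ Δf(x₀ + W_r) dr]`.
[cite: Legall2016, Ch. 6 Thm. 6.14 and the Example following it] -/
theorem integral_indicator_mul_sub_eq_integral_lap [IsProbabilityMeasure P] (hW : IsBrownianVec W P)
    (hf : ContDiff ℝ 2 f) (hc : HasCompactSupport f) {s t : ℝ≥0} (hst : s ≤ t) {B : Set Ω}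
    (hB : MeasurableSet[hW.natFiltration s] B) :
    ∫ ω, B.indicator (fun _ ↦ (1 : ℝ)) ω * (f (x₀ + W t ω) - f (x₀ + W s ω)) ∂P =
      ∫ ω, B.indicator (fun _ ↦ (1 : ℝ)) ω *
        (1 / 2 * ∫ r in (s : ℝ)..t, lap f (x₀ + W r.toNNReal ω)) ∂P := by
  have hBm : MeasurableSet B := hW.natFiltration.le s _ hB
  obtain ⟨Cf, hCf⟩ := exists_bound_of_hasCompactSupport hf hc
  obtain ⟨CL, hCL0, hCL⟩ := exists_bound_lap hf hc
  have hts : (0 : ℝ) ≤ t - s := sub_nonneg.2 (NNReal.coe_le_coe.2 hst)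
  -- notation
  set A : ℝ := ∫ ω, B.indicator (fun _ ↦ (1 : ℝ)) ω * (f (x₀ + W t ω) - f (x₀ + W s ω)) ∂P with hA
  set cseq : ℕ → ℝ := fun n ↦ ∫ ω, B.indicator (fun _ ↦ (1 : ℝ)) ω *
    (1 / 2 * riemannLap f x₀ W s t n ω) ∂P with hcseq
  set c : ℝ := ∫ ω, B.indicator (fun _ ↦ (1 : ℝ)) ω *
    (1 / 2 * ∫ r in (s : ℝ)..t, lap f (x₀ + W r.toNNReal ω)) ∂P with hcdef
  -- measurability helpers
  have hmf : ∀ r, Measurable fun ω ↦ f (x₀ + W r ω) := fun r ↦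
    hf.continuous.measurable.comp (measurable_const.add (hW.measurable r))
  have hml : ∀ r, Measurable fun ω ↦ lap f (x₀ + W r ω) := fun r ↦
    (continuous_lap hf).measurable.comp (measurable_const.add (hW.measurable r))
  -- (1) `cseq n → c` by dominated convergence
  have hlim : Tendsto cseq atTop (𝓝 c) := by
    refine tendsto_integral_of_dominated_convergence (fun _ ↦ 1 / 2 * (CL * (t - s))) ?_
      (integrable_const _) ?_ ?_
    · intro n
      exact ((measurable_const.indicator hBm).mul
        (((hW.measurable_riemannLap hf hst n).mono (hW.natFiltration.le t) le_rfl).const_mul _)).aestronglyMeasurable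
    · intro n
      refine Eventually.of_forall fun ω ↦ ?_
      have h1 := abs_riemannLap_le (x₀ := x₀) (W := W) hCL0 hCL hst n ω
      rw [Real.norm_eq_abs, abs_mul, abs_mul, abs_of_pos (by norm_num : (0 : ℝ) < 1 / 2)]
      by_cases hω : ω ∈ B
      · simp only [hω, Set.indicator_of_mem, abs_one, one_mul]; gcongr
      · simp only [hω, Set.indicator_of_notMem, not_false_eq_true, abs_zero, zero_mul]; positivity
    · refine Eventually.of_forall fun ω ↦ ?_
      exact ((hW.tendsto_riemannLap hf hst ω).const_mul _).const_mul _
  -- (2) for every `ε > 0`, eventually `|A − cseq n| ≤ ε (t − s)`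
  have hclose : ∀ ε : ℝ, 0 < ε → ∀ᶠ n in atTop, |A - cseq n| ≤ ε * (t - s) := by
    intro ε hε
    obtain ⟨h₀, hh₀, hstep⟩ := gaussVec_integral_taylor (d := d) hf hc hε
    -- eventually the mesh `(t - s)/n` is below `h₀`
    have hmesh : ∀ᶠ n : ℕ in atTop, ((t - s) / n : ℝ≥0) < h₀.toNNReal ∧ n ≠ 0 := by
      obtain ⟨N, hN⟩ := exists_nat_gt (((t : ℝ) - s) / h₀)
      refine eventually_atTop.2 ⟨max N 1, fun n hn ↦ ⟨?_, ?_⟩⟩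
      · have hn1 : (0 : ℝ) < n := by exact_mod_cast le_of_max_le_right hn
        rw [← NNReal.coe_lt_coe, NNReal.coe_div, NNReal.coe_sub hst, NNReal.coe_natCast,
          Real.coe_toNNReal _ hh₀.le, div_lt_iff₀ hn1]
        have : ((t : ℝ) - s) / h₀ < n := hN.trans_le (by exact_mod_cast le_of_max_le_left hn)
        rw [div_lt_iff₀ hh₀] at this
        linarith
      · exact Nat.one_le_iff_ne_zero.1 (le_of_max_le_right hn)
    filter_upwards [hmesh] with n ⟨hn, hn0⟩
    set hn' : ℝ≥0 := (t - s) / n with hhn'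
    have hhn'real : (hn' : ℝ) = ((t : ℝ) - s) / n := by
      rw [hhn', NNReal.coe_div, NNReal.coe_sub hst, NNReal.coe_natCast]
    have hlt : (hn' : ℝ) < h₀ := by
      have := NNReal.coe_lt_coe.2 hn
      rwa [Real.coe_toNNReal _ hh₀.le] at this
    -- telescoping: `A = ∑_k E[𝟙_B (f(W_{g(k+1)}) − f(W_{g k}))]`
    have hAsum : A = ∑ k ∈ Finset.range n, ∫ ω, B.indicator (fun _ ↦ (1 : ℝ)) ω *
        (f (x₀ + W (grid s t n (k + 1)) ω) - f (x₀ + W (grid s t n k) ω)) ∂P := by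
      rw [← integral_finsetSum _ fun k _ ↦ integrable_indicator_mul hBm
        (g := fun ω ↦ f (x₀ + W (grid s t n (k + 1)) ω) - f (x₀ + W (grid s t n k) ω))
        ((hmf _).sub (hmf _)) (C := Cf + Cf) fun ω ↦ (abs_sub _ _).trans (add_le_add (hCf _) (hCf _))]
      refine integral_congr_ae (Eventually.of_forall fun ω ↦ ?_)
      show _ = ∑ i ∈ Finset.range n, B.indicator (fun _ ↦ (1 : ℝ)) ω *
        (f (x₀ + W (grid s t n (i + 1)) ω) - f (x₀ + W (grid s t n i) ω))
      rw [← Finset.mul_sum, Finset.sum_range_sub (fun k ↦ f (x₀ + W (grid s t n k) ω)), grid_zero,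
        grid_self hst hn0]
    -- each term equals `E[𝟙_B G(x₀ + W_{g k})]`
    have hterm : ∀ k ∈ Finset.range n, ∫ ω, B.indicator (fun _ ↦ (1 : ℝ)) ω *
        (f (x₀ + W (grid s t n (k + 1)) ω) - f (x₀ + W (grid s t n k) ω)) ∂P =
        ∫ ω, B.indicator (fun _ ↦ (1 : ℝ)) ω * gaussStep f hn' (x₀ + W (grid s t n k) ω) ∂P := by
      intro k _
      rw [grid_succ]
      exact hW.integral_indicator_mul_sub_eq hf hc
        (hW.natFiltration.mono (le_grid s t n k) _ hB)
    -- compare with `E[𝟙_B (h/2) Δf(x₀ + W_{g k})]`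
    obtain ⟨CG, hCG⟩ := abs_gaussStep_le hf hc hn' (d := d)
    have hdiff : ∀ k ∈ Finset.range n, |∫ ω, B.indicator (fun _ ↦ (1 : ℝ)) ω *
        gaussStep f hn' (x₀ + W (grid s t n k) ω) ∂P -
        ∫ ω, B.indicator (fun _ ↦ (1 : ℝ)) ω *
          ((hn' : ℝ) / 2 * lap f (x₀ + W (grid s t n k) ω)) ∂P| ≤ ε * hn' := by
      intro k _
      have hi1 := integrable_indicator_mul (P := P) hBm
        (g := fun ω ↦ gaussStep f hn' (x₀ + W (grid s t n k) ω))
        ((measurable_gaussStep hf hn').comp (measurable_const.add (hW.measurable (grid s t n k))))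
        fun ω ↦ hCG _
      have hi2 := integrable_indicator_mul (P := P) hBm
        (g := fun ω ↦ (hn' : ℝ) / 2 * lap f (x₀ + W (grid s t n k) ω))
        ((hml (grid s t n k)).const_mul ((hn' : ℝ) / 2)) (C := (hn' : ℝ) / 2 * CL) fun ω ↦ by
          rw [abs_mul, abs_of_nonneg (by positivity)]; gcongr; exact hCL _
      rw [← integral_sub hi1 hi2]
      calc |∫ ω, B.indicator (fun _ ↦ (1 : ℝ)) ω * gaussStep f hn' (x₀ + W (grid s t n k) ω) -
              B.indicator (fun _ ↦ (1 : ℝ)) ω * ((hn' : ℝ) / 2 * lap f (x₀ + W (grid s t n k) ω)) ∂P|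
          ≤ ∫ ω, |B.indicator (fun _ ↦ (1 : ℝ)) ω * gaussStep f hn' (x₀ + W (grid s t n k) ω) -
              B.indicator (fun _ ↦ (1 : ℝ)) ω * ((hn' : ℝ) / 2 * lap f (x₀ + W (grid s t n k) ω))| ∂P :=
            abs_integral_le_integral_abs
        _ ≤ ∫ _, ε * hn' ∂P := by
            refine integral_mono (hi1.sub hi2).abs (integrable_const _) fun ω ↦ ?_
            rw [← mul_sub, abs_mul]
            have h2 := hstep hn' hlt (x₀ + W (grid s t n k) ω)
            rw [gaussStep]
            by_cases hω : ω ∈ B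
            · simpa [hω] using h2
            · simp [hω, (abs_nonneg _).trans h2]
        _ = ε * hn' := by simp
    -- sum the comparisons
    have hcseq_sum : cseq n = ∑ k ∈ Finset.range n, ∫ ω, B.indicator (fun _ ↦ (1 : ℝ)) ω *
        ((hn' : ℝ) / 2 * lap f (x₀ + W (grid s t n k) ω)) ∂P := by
      rw [← integral_finsetSum _ fun k _ ↦ integrable_indicator_mul hBm
        (g := fun ω ↦ (hn' : ℝ) / 2 * lap f (x₀ + W (grid s t n k) ω))
        ((hml (grid s t n k)).const_mul ((hn' : ℝ) / 2)) (C := (hn' : ℝ) / 2 * CL) fun ω ↦ by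
          rw [abs_mul, abs_of_nonneg (by positivity)]; gcongr; exact hCL _]
      refine integral_congr_ae (Eventually.of_forall fun ω ↦ ?_)
      simp only [riemannLap, Finset.mul_sum, hhn'real]
      refine Finset.sum_congr rfl fun k _ ↦ by ring
    rw [hAsum, Finset.sum_congr rfl hterm, hcseq_sum, ← Finset.sum_sub_distrib]
    calc |∑ k ∈ Finset.range n, (∫ ω, B.indicator (fun _ ↦ (1 : ℝ)) ω *
            gaussStep f hn' (x₀ + W (grid s t n k) ω) ∂P -
          ∫ ω, B.indicator (fun _ ↦ (1 : ℝ)) ω * ((hn' : ℝ) / 2 * lap f (x₀ + W (grid s t n k) ω)) ∂P)|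
        ≤ ∑ k ∈ Finset.range n, ε * hn' := (Finset.abs_sum_le_sum_abs _ _).trans (Finset.sum_le_sum hdiff)
      _ = ε * (t - s) := by
          rw [Finset.sum_const, Finset.card_range, nsmul_eq_mul, hhn'real]
          field_simp
  -- (3) conclude
  have hfinal : ∀ ε : ℝ, 0 < ε → |A - c| ≤ ε * (t - s) := fun ε hε ↦
    le_of_tendsto ((tendsto_const_nhds.sub hlim).abs) (hclose ε hε)
  have h0 : |A - c| ≤ 0 := by
    by_contra hlt
    push Not at hlt
    rcases hts.eq_or_lt with hzero | hpos
    · have := hfinal 1 one_pos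
      rw [← hzero, mul_zero] at this
      exact absurd this (not_le.2 hlt)
    · have := hfinal (|A - c| / (2 * (t - s))) (by positivity)
      rw [div_mul_eq_mul_div, le_div_iff₀ (by positivity)] at this
      nlinarith [abs_nonneg (A - c)]
  exact sub_eq_zero.1 (abs_nonpos_iff.1 h0)

/-- **Dynkin's formula: `M^f` is a martingale of the natural filtration of `W`.** For `f` of class
`C²` with compact support and every `x₀`,
`f(x₀ + W_t) − f(x₀) − ½∫₀ᵗ Δf(x₀ + W_r) dr` is an `𝓕^W`-martingale.
[cite: Legall2016, Ch. 6 Thm. 6.14 and the Example following it] -/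
theorem martingale_dynkin [IsProbabilityMeasure P] (hW : IsBrownianVec W P) (hf : ContDiff ℝ 2 f)
    (hc : HasCompactSupport f) (x₀ : Fin d → ℝ) :
    Martingale (dynkin f x₀ W) hW.natFiltration P := by
  refine ⟨hW.stronglyAdapted_dynkin hf, fun s t hst ↦ ?_⟩
  symm
  refine ae_eq_condExp_of_forall_setIntegral_eq (hW.natFiltration.le s) (hW.integrable_dynkin hf hc t)
    (fun B _ _ ↦ (hW.integrable_dynkin hf hc s).integrableOn) (fun B hB _ ↦ ?_)
    (hW.stronglyAdapted_dynkin hf s).aestronglyMeasurable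
  have hBm : MeasurableSet B := hW.natFiltration.le s _ hB
  -- `∫_B (M_t − M_s) = 0`
  rw [← sub_eq_zero, ← integral_sub (hW.integrable_dynkin hf hc s).integrableOn
    (hW.integrable_dynkin hf hc t).integrableOn, ← integral_indicator hBm]
  have hind : ∀ ω, B.indicator (fun ω ↦ dynkin f x₀ W s ω - dynkin f x₀ W t ω) ω =
      -(B.indicator (fun _ ↦ (1 : ℝ)) ω * (f (x₀ + W t ω) - f (x₀ + W s ω))) +
        B.indicator (fun _ ↦ (1 : ℝ)) ω * (1 / 2 * ∫ r in (s : ℝ)..t, lap f (x₀ + W r.toNNReal ω)) := by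
    intro ω
    by_cases hω : ω ∈ B
    · simp only [hω, Set.indicator_of_mem, one_mul]
      rw [← neg_sub, hW.dynkin_sub hf]
      ring
    · simp [hω]
  simp_rw [hind]
  obtain ⟨Cf, hCf⟩ := exists_bound_of_hasCompactSupport hf hc
  obtain ⟨CL, -, hCL⟩ := exists_bound_lap hf hc
  have hmf : ∀ r, Measurable fun ω ↦ f (x₀ + W r ω) := fun r ↦
    hf.continuous.measurable.comp (measurable_const.add (hW.measurable r))
  have hi1 := integrable_indicator_mul (P := P) hBm (g := fun ω ↦ f (x₀ + W t ω) - f (x₀ + W s ω))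
    ((hmf t).sub (hmf s)) (C := Cf + Cf) fun ω ↦ (abs_sub _ _).trans (add_le_add (hCf _) (hCf _))
  have hi1n : Integrable (fun ω ↦ -(B.indicator (fun _ ↦ (1 : ℝ)) ω * (f (x₀ + W t ω) - f (x₀ + W s ω)))) P :=
    hi1.neg
  have hi2 := integrable_indicator_mul (P := P) hBm
    (g := fun ω ↦ 1 / 2 * ∫ r in (s : ℝ)..t, lap f (x₀ + W r.toNNReal ω))
    (((hW.stronglyMeasurable_integral_lap hf (x₀ := x₀) hst).measurable.mono (hW.natFiltration.le t)
      le_rfl).const_mul (1 / 2)) (C := 1 / 2 * (CL * |(t : ℝ) - s|)) fun ω ↦ by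
      rw [abs_mul, abs_of_pos (by norm_num : (0 : ℝ) < 1 / 2)]
      gcongr
      exact abs_integral_lap_le hCL _ _ ω
  rw [integral_add hi1n hi2, integral_neg, hW.integral_indicator_mul_sub_eq_integral_lap hf hc hst hB]
  ring

end IsBrownianVec

end Literature.Probability.Process

end
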